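import Literature.Combinatorics.Sahi2008.FKGCumulation

/-!
# The change-of-weight factor of the principal-slot identity: a SHARP coefficient bound, and domination of
# `E_{k+2}(1_P, g)` over `E_{k+1}(1_P, g_{−i})` (abstract form, every `k`)

Helper file of the one-cut programme (crux `NoHeavyLowerTail`, stmt-CriticalPhenomena-4575; cell `prim-masterthm`, unit
`prim-masterthm-p4` = "induction on `k` through the FKG-lattice structure").  Companion of
`Literature.Combinatorics.Sahi2008.FKGCumulation` (Blinovsky's principal-slot identity, [Blinovsky2013; Sahi2008, Prop. 12])
and of `SahiMasterFamilyPrincipalDomination.lean` (the event-level consequences).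

THE IDENTITY (tree, `FKGCumulation`, private there and re-used here via `open private`): for a probability weight `μ`,
a set `P` of mass `m` with conditional weight `μ'` (`m·μ' = μ·1_P`) and a family `g = (g_0,…,g_k)`,
  `E^μ_{k+2}(1_P, g) = [t^{univ}] Q_{μ,P}(g)`,   `Q_{μ,P}(g) = m · Q_{μ',univ}(g) · W`,   `W = ∏_x (1 − Σ_i t_i g_i(x))^{μ(x)−μ'(x)}`
in the square-free algebra `ℝ[t_0..t_k]/(t_i²)`, with `[t^S] Q_{μ',univ}(g) = E^{μ'}_{|S|+1}(1, g|_S)` (restriction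
homomorphism) and `W ≥ 0` coefficientwise from the derivation equation `D W = W·V`,
`[t^ρ]V = |ρ|!·Σ_x (μ'(x) − μ(x)) ∏_{i∈ρ} g_i(x) ≥ 0` (Harris/FKG for the up-set `P`).

NEW HERE (every `k`, any finite type, any weights satisfying the displayed hypotheses):
* `coeff_ge_of_D_eq_mul` — the SHARP form of "positivity from a derivation equation": if `D W = W·V`, `V ≥ 0`,
  `V_∅ = 0`, `W_∅ ≥ 0`, then `W_τ ≥ V_{{i}} · W_{τ∖{i}}` for every `τ ∋ i` (the coefficients of `W` are the set-partition
  sums `Σ_{π ⊢ τ} ∏_{B∈π} V_B/|B|`; the partitions in which `i` is a singleton give the bound; proved by induction on `|τ|`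
  directly from `|τ|·W_τ = Σ_{σ⊆τ} W_σ V_{τ∖σ}`);
* `coeff_changeWeight_ge` — hence `[t^τ]W ≥ δ_i·[t^{τ∖i}]W`, `δ_i = Σ_x (μ'(x) − μ(x)) g_i(x) = E_{μ'}g_i − E_μ g_i`;
* `coeff_mul_ge_of_coeff_ge` — the bound survives multiplication by a series with nonnegative coefficients;
* `sahiE_cons_setInd_ge_erase` — **PRINCIPAL-SLOT DOMINATION (abstract)**: since `E^μ_{k+1}(1_P, g_{−i})` is the
  coefficient of `t^{univ∖i}` of the SAME series `Q_{μ,P}(g)`,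
      `E^μ_{k+2}(1_P, g_0,…,g_k) ≥ (E_{μ'} g_i − E_μ g_i) · E^μ_{k+1}(1_P, g_{−i})`   for every slot `i`,
  given `Σ_x (μ'−μ)∏_{ρ} g ≥ 0` (all `ρ`) and `E^{μ'}_{j+1}(1, g|_S) ≥ 0` for the sub-families (`= (j−1)E^{μ'}_j(g|_S)`);
* `sahiE_cons_setInd_nonneg_of_subfamilies` — positivity of `E^μ_{k+1}(1_P, g)` from the SPECIFIC sub-family functionals
  under `μ'` (the sharp form of the principal-slot rule of the `k`-induction; the tree's `sahiE_nonneg_offK_of_condClosed`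
  assumes order-`K` positivity of a whole conditioning-closed class instead).
Pure algebra; nothing here is specific to product measures and nothing asserts `C_k`. [this work]
-/

set_option autoImplicit false

open Finset

open private coeff_mul coeff_one coeff_zero coeff_C_mul coeff_sum coeff_D coeff_sub D_prod D_binomB D_lin binomB_sub_one
  mul_inv1 isNil_lin coeff_empty_binomB from Literature.Combinatorics.Sahi2008.CumulationCone

open private zProd qMark res coeff_res res_qMark res_zProd sahiE_cons_setInd_eq sahiE_cons_one_eq qMark_eq_of_cond
  coeff_changeWeight_nonneg coeff_inv1_lin coeff_nonneg_of_D_eq_mul coeff_empty_prod map_univ_orderEmbOfFin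
  from Literature.Combinatorics.Sahi2008.FKGCumulation

namespace Summit.CriticalPhenomena.PercolationContinuityZ3.Theorems

open Literature.Combinatorics.Sahi2008
open Literature.Combinatorics.Sahi2008.SqFree

/-! ### Square-free algebra: a sharp lower bound from the derivation equation -/

section Algebra

variable {κ : Type*} [DecidableEq κ]

/-- For `i ∈ τ`, `τ \ τ.erase i = {i}`. [folklore] -/
theorem sdiff_erase_self_eq {τ : Finset κ} {i : κ} (hi : i ∈ τ) : τ \ τ.erase i = {i} := by
  ext j
  simp only [mem_sdiff, mem_erase, not_and, mem_singleton]
  constructor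
  · rintro ⟨hj, h⟩
    by_contra hji
    exact h hji hj
  · rintro rfl
    exact ⟨hi, fun h _ => (h rfl).elim⟩

/-- For `i ∉ s` and `σ ⊆ s`, `insert i s \ insert i σ = s \ σ`. [folklore] -/
theorem insert_sdiff_insert_eq {s σ : Finset κ} {i : κ} (hi : i ∉ s) :
    insert i s \ insert i σ = s \ σ := by
  ext j
  simp only [mem_sdiff, mem_insert, not_or]
  constructor
  · rintro ⟨hj | hj, hji, hjσ⟩
    · exact (hji hj).elim
    · exact ⟨hj, hjσ⟩
  · rintro ⟨hj, hjσ⟩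
    exact ⟨Or.inr hj, fun h => hi (h ▸ hj), hjσ⟩

/-- For `i ∉ σ`, `(insert i s \ σ).erase i = s \ σ` when `i ∉ s`. [folklore] -/
theorem erase_insert_sdiff_eq {s σ : Finset κ} {i : κ} (hi : i ∉ s) :
    (insert i s \ σ).erase i = s \ σ := by
  ext j
  simp only [mem_erase, mem_sdiff, mem_insert]
  constructor
  · rintro ⟨hji, hj | hj, hjσ⟩
    · exact (hji hj).elim
    · exact ⟨hj, hjσ⟩
  · rintro ⟨hj, hjσ⟩
    exact ⟨fun h => hi (h ▸ hj), Or.inr hj, hjσ⟩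

/-- **Sharp lower bound from a derivation equation.**  If `D W = W·V` in the square-free algebra, `V` has
nonnegative coefficients and no constant term, and `W_∅ ≥ 0`, then for every `τ ∋ i`,
`W_τ ≥ V_{{i}} · W_{τ∖{i}}` (refining `coeff_nonneg_of_D_eq_mul`: the coefficients of `W` are the partition sums
`Σ_π ∏_{B∈π} V_B/|B|`, and the partitions with the singleton block `{i}` contribute `V_{{i}}·W_{τ∖{i}}`; proved
here by induction on `|τ|` straight from the equation `|τ|·W_τ = Σ_{σ ⊆ τ} W_σ V_{τ∖σ}`). [this work] -/
theorem coeff_ge_of_D_eq_mul {W V : SqFree κ ℝ} (hD : D W = W * V) (hV0 : V.coeff ∅ = 0)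
    (hV : ∀ ρ, 0 ≤ V.coeff ρ) (hW0 : 0 ≤ W.coeff ∅) (i : κ) :
    ∀ τ : Finset κ, i ∈ τ → V.coeff {i} * W.coeff (τ.erase i) ≤ W.coeff τ := by
  have hWnn : ∀ τ, 0 ≤ W.coeff τ := coeff_nonneg_of_D_eq_mul hD hV0 hV hW0
  -- the coefficient equation `|τ| W_τ = Σ_{σ ⊆ τ} W_σ V_{τ \ σ}`
  have key : ∀ τ : Finset κ, (τ.card : ℝ) * W.coeff τ = ∑ σ ∈ τ.powerset, W.coeff σ * V.coeff (τ \ σ) := by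
    intro τ
    have h := congrArg (fun z => z.coeff τ) hD
    simp only [coeff_D] at h
    rw [h, coeff_mul]
  intro τ
  induction' hN : τ.card using Nat.strong_induction_on with N ih generalizing τ
  intro hi
  set s := τ.erase i with hs_def
  have his : i ∉ s := Finset.notMem_erase i τ
  have hτ : τ = insert i s := (Finset.insert_erase hi).symm
  have hscard : s.card + 1 = N := by rw [hs_def, Finset.card_erase_add_one hi, hN]
  -- split the coefficient equation for `τ` along `σ ∌ i` / `σ ∋ i`
  have hsplit : (τ.card : ℝ) * W.coeff τ =
      (∑ σ ∈ s.powerset, W.coeff σ * V.coeff (τ \ σ)) +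
        ∑ σ ∈ s.powerset, W.coeff (insert i σ) * V.coeff (τ \ insert i σ) := by
    rw [key τ]
    conv_lhs => rw [hτ]
    rw [Finset.sum_powerset_insert his]
    rw [← hτ]
  -- first block: the term `σ = s` is `W_s V_{{i}}`, the rest is nonnegative
  have h1 : W.coeff s * V.coeff {i} ≤ ∑ σ ∈ s.powerset, W.coeff σ * V.coeff (τ \ σ) := by
    have hmem : s ∈ s.powerset := Finset.mem_powerset.2 (Finset.Subset.refl s)
    have := Finset.single_le_sum (f := fun σ => W.coeff σ * V.coeff (τ \ σ))
      (fun σ _ => mul_nonneg (hWnn σ) (hV _)) hmem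
    rw [hs_def, sdiff_erase_self_eq hi] at this
    rw [hs_def]
    exact this
  -- second block: termwise `W_{insert i σ} V_{τ \ insert i σ} ≥ V_{{i}} W_σ V_{s \ σ}` (induction; `σ = s` gives `0 = 0`)
  have h2 : V.coeff {i} * ∑ σ ∈ s.powerset, W.coeff σ * V.coeff (s \ σ) ≤
      ∑ σ ∈ s.powerset, W.coeff (insert i σ) * V.coeff (τ \ insert i σ) := by
    rw [Finset.mul_sum]
    refine Finset.sum_le_sum fun σ hσ => ?_
    have hσs : σ ⊆ s := Finset.mem_powerset.1 hσ
    rw [hτ, insert_sdiff_insert_eq his]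
    by_cases hσeq : σ = s
    · rw [hσeq, sdiff_self, Finset.bot_eq_empty, hV0, mul_zero, mul_zero, mul_zero]
    · have hlt : (insert i σ).card < N := by
        rw [Finset.card_insert_of_notMem (fun h => his (hσs h)), ← hscard]
        have := Finset.card_lt_card ((Finset.ssubset_iff_subset_ne).2 ⟨hσs, hσeq⟩)
        omega
      have hIH := ih (insert i σ).card hlt (insert i σ) rfl (Finset.mem_insert_self i σ)
      rw [Finset.erase_insert (fun h => his (hσs h))] at hIH
      rw [← mul_assoc]
      exact mul_le_mul_of_nonneg_right hIH (hV _)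
  -- assemble: `|τ| W_τ ≥ V_i W_s + V_i |s| W_s = |τ| V_i W_s`
  have h3 : (τ.card : ℝ) * (V.coeff {i} * W.coeff s) ≤ (τ.card : ℝ) * W.coeff τ := by
    rw [← key s] at h2
    rw [hsplit]
    have hc : (τ.card : ℝ) = s.card + 1 := by
      rw [hN, ← hscard]; push_cast; ring
    rw [hc]
    have := add_le_add h1 h2
    linarith [this]
  have hNpos : (0 : ℝ) < τ.card := by exact_mod_cast Finset.card_pos.2 ⟨i, hi⟩
  exact le_of_mul_le_mul_left h3 hNpos

/-- **Product with a nonnegative series preserves the bound.**  If `A, W` have nonnegative coefficients and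
`W_τ ≥ c·W_{τ∖{i}}` for every `τ ∋ i`, then `(A·W)_τ ≥ c·(A·W)_{τ∖{i}}` for every `τ ∋ i` (drop the terms of the
convolution whose first factor contains `i`). [this work] -/
theorem coeff_mul_ge_of_coeff_ge {A W : SqFree κ ℝ} (hA : ∀ τ, 0 ≤ A.coeff τ) (hW : ∀ τ, 0 ≤ W.coeff τ)
    {c : ℝ} (i : κ) (hWi : ∀ τ, i ∈ τ → c * W.coeff (τ.erase i) ≤ W.coeff τ) (τ : Finset κ) (hi : i ∈ τ) :
    c * (A * W).coeff (τ.erase i) ≤ (A * W).coeff τ := by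
  set s := τ.erase i with hs_def
  have his : i ∉ s := Finset.notMem_erase i τ
  have hτ : τ = insert i s := (Finset.insert_erase hi).symm
  have hR : (A * W).coeff τ = (∑ σ ∈ s.powerset, A.coeff σ * W.coeff (insert i s \ σ)) +
      ∑ σ ∈ s.powerset, A.coeff (insert i σ) * W.coeff (insert i s \ insert i σ) := by
    rw [coeff_mul, hτ, Finset.sum_powerset_insert his]
  rw [hR, coeff_mul]
  have hnn : 0 ≤ ∑ σ ∈ s.powerset, A.coeff (insert i σ) * W.coeff (insert i s \ insert i σ) :=
    Finset.sum_nonneg fun σ _ => mul_nonneg (hA _) (hW _)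
  have hmain : c * ∑ σ ∈ s.powerset, A.coeff σ * W.coeff (s \ σ) ≤
      ∑ σ ∈ s.powerset, A.coeff σ * W.coeff (insert i s \ σ) := by
    rw [Finset.mul_sum]
    refine Finset.sum_le_sum fun σ hσ => ?_
    have hσs : σ ⊆ s := Finset.mem_powerset.1 hσ
    have hiτσ : i ∈ insert i s \ σ := Finset.mem_sdiff.2 ⟨Finset.mem_insert_self i s, fun h => his (hσs h)⟩
    have hb := hWi (insert i s \ σ) hiτσ
    rw [erase_insert_sdiff_eq his] at hb
    calc c * (A.coeff σ * W.coeff (s \ σ)) = A.coeff σ * (c * W.coeff (s \ σ)) := by ring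
      _ ≤ A.coeff σ * W.coeff (insert i s \ σ) := mul_le_mul_of_nonneg_left hb (hA σ)
  linarith [hmain, hnn]

end Algebra

/-! ### The change-of-weight factor: derivation equation and the sharp coefficient bound -/

section GF

variable {α : Type*} [Fintype α]

/-- The derivation equation `D W = W·V` of the change-of-weight factor `W = ∏_x (1 - Σ t_i g_i(x))^{μ(x)-μ'(x)}`,
with `V = Σ_x (μ'(x) - μ(x))·u_x(1-u_x)⁻¹` (the computation inside the tree's `coeff_changeWeight_nonneg`, exported).
[folklore] -/
theorem changeWeight_D_eq (μ μ' : α → ℝ) {k : ℕ} (g : Fin k → α → ℝ) :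
    D (∏ x, binomB (μ x - μ' x) (lin g x)) =
      (∏ x, binomB (μ x - μ' x) (lin g x)) * ∑ x, C (μ' x - μ x) * (lin g x * inv1 (lin g x)) := by
  classical
  have hu : ∀ x, (lin g x).IsNil := fun x => isNil_lin g x
  rw [D_prod]
  have ht : ∀ x ∈ (univ : Finset α),
      (∏ y ∈ univ.erase x, binomB (μ y - μ' y) (lin g y)) * D (binomB (μ x - μ' x) (lin g x))
        = (∏ y, binomB (μ y - μ' y) (lin g y)) * (C (μ' x - μ x) * (lin g x * inv1 (lin g x))) := by
    intro x _
    rw [D_binomB (hu x), D_lin, binomB_sub_one (hu x)]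
    have : (∏ y ∈ univ.erase x, binomB (μ y - μ' y) (lin g y)) *
        -(C (μ x - μ' x) * lin g x * (binomB (μ x - μ' x) (lin g x) * inv1 (lin g x)))
        = -(C (μ x - μ' x) * (lin g x * inv1 (lin g x)) *
            ((∏ y ∈ univ.erase x, binomB (μ y - μ' y) (lin g y)) * binomB (μ x - μ' x) (lin g x))) := by
      ring
    rw [this, Finset.prod_erase_mul _ _ (mem_univ x)]
    have hC : (C (μ' x - μ x) : SqFree (Fin k) ℝ) = -C (μ x - μ' x) := by
      rw [← map_neg]; congr 1; ring
    rw [hC]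
    ring
  rw [Finset.sum_congr rfl ht, ← Finset.mul_sum]

/-- The coefficients of `V = Σ_x (μ'(x) - μ(x))·u_x(1-u_x)⁻¹`: `[t^ρ]V = |ρ|!·Σ_x (μ'(x)-μ(x))∏_{i∈ρ} g_i(x)` for
`ρ ≠ ∅`, and `V_∅ = 0`. [folklore] -/
theorem coeff_changeWeightV (μ μ' : α → ℝ) {k : ℕ} (g : Fin k → α → ℝ) (ρ : Finset (Fin k)) :
    (∑ x, C (μ' x - μ x) * (lin g x * inv1 (lin g x))).coeff ρ =
      ∑ x, (μ' x - μ x) * ((ρ.card.factorial : ℝ) * ∏ i ∈ ρ, g i x - if ρ = ∅ then 1 else 0) := by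
  classical
  rw [coeff_sum]
  refine Finset.sum_congr rfl fun x _ => ?_
  rw [coeff_C_mul, mul_inv1 (isNil_lin g x), coeff_sub, coeff_inv1_lin, coeff_one]

/-- **Sharp bound for the change-of-weight factor.**  If `Σ_x (μ'(x) - μ(x)) ∏_{i∈ρ} g_i(x) ≥ 0` for every `ρ`
(Harris/FKG for `μ' = μ(·|P)`), then for every `τ ∋ i`,
`[t^τ]W ≥ δ_i·[t^{τ∖i}]W` with `δ_i = Σ_x (μ'(x) - μ(x)) g_i(x)` (`= E_{μ'} g_i - E_μ g_i`). [this work] -/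
theorem coeff_changeWeight_ge (μ μ' : α → ℝ) {k : ℕ} (g : Fin k → α → ℝ)
    (H : ∀ ρ : Finset (Fin k), 0 ≤ ∑ x, (μ' x - μ x) * ∏ i ∈ ρ, g i x) (i : Fin k)
    (τ : Finset (Fin k)) (hi : i ∈ τ) :
    (∑ x, (μ' x - μ x) * g i x) * (∏ x, binomB (μ x - μ' x) (lin g x)).coeff (τ.erase i) ≤
      (∏ x, binomB (μ x - μ' x) (lin g x)).coeff τ := by
  classical
  have hV0 : (∑ x, C (μ' x - μ x) * (lin g x * inv1 (lin g x))).coeff ∅ = 0 := by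
    rw [coeff_changeWeightV]; simp
  have hV : ∀ ρ, 0 ≤ (∑ x, C (μ' x - μ x) * (lin g x * inv1 (lin g x))).coeff ρ := by
    intro ρ
    rw [coeff_changeWeightV]
    by_cases hρ : ρ = ∅
    · subst hρ; simp
    · simp only [hρ, if_false, sub_zero]
      have : ∑ x, (μ' x - μ x) * ((ρ.card.factorial : ℝ) * ∏ i ∈ ρ, g i x)
          = (ρ.card.factorial : ℝ) * ∑ x, (μ' x - μ x) * ∏ i ∈ ρ, g i x := by
        rw [Finset.mul_sum]
        exact Finset.sum_congr rfl fun x _ => by ring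
      rw [this]
      exact mul_nonneg (Nat.cast_nonneg _) (H ρ)
  have hW0 : 0 ≤ (∏ x, binomB (μ x - μ' x) (lin g x)).coeff ∅ := by
    rw [coeff_empty_prod]
    exact Finset.prod_nonneg fun x _ => by rw [coeff_empty_binomB (isNil_lin g x)]; exact zero_le_one
  have h := coeff_ge_of_D_eq_mul (changeWeight_D_eq μ μ' g) hV0 hV hW0 i τ hi
  have hVi : (∑ x, C (μ' x - μ x) * (lin g x * inv1 (lin g x))).coeff {i} = ∑ x, (μ' x - μ x) * g i x := by
    rw [coeff_changeWeightV]
    refine Finset.sum_congr rfl fun x _ => ?_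
    simp
  rwa [hVi] at h

/-- The image of `univ` under `Fin.succAboveEmb i` is `univ.erase i`. [folklore] -/
theorem map_univ_succAboveEmb {k : ℕ} (i : Fin (k + 1)) :
    (univ : Finset (Fin k)).map (Fin.succAboveEmb i) = univ.erase i := by
  ext x
  simp only [Finset.mem_map, Finset.mem_univ, true_and, Fin.succAboveEmb_apply, Finset.mem_erase, and_true]
  exact Fin.exists_succAbove_eq_iff

/-- `E_{k+1}(1_P, g) = 0` when `μ` vanishes on `P`. [folklore] -/
theorem sahiE_cons_setInd_eq_zero_of_null [DecidableEq α] (μ : α → ℝ) (hμ1 : ∑ x, μ x = 1) (P : Finset α)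
    (hP : ∀ x ∈ P, μ x = 0) {k : ℕ} (g : Fin k → α → ℝ) :
    sahiE μ (k + 1) (Matrix.vecCons (setInd P) g) = 0 := by
  have hμ' : ∀ x, (0 : ℝ) * μ x = if x ∈ P then μ x else 0 := fun x => by
    rw [zero_mul]
    split_ifs with h
    · exact (hP x h).symm
    · rfl
  rw [sahiE_cons_setInd_eq μ hμ1 P g, qMark_eq_of_cond μ μ P 0 hμ' g, map_zero, zero_mul, coeff_zero]

/-- **Principal-slot domination, abstract form.**  Let `μ` be a probability weight, `P` a set of positive mass
`m` with conditional weight `μ'` (`m·μ' = μ·1_P`, `Σ μ' = 1`) such that (i) `Σ_x (μ'(x)-μ(x))∏_{i∈ρ} g_i(x) ≥ 0` for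
all `ρ` (for an up-set `P` of an FKG weight and nonnegative monotone `g_i`: the FKG inequality) and (ii) the
marked functionals `E^{μ'}_{j+1}(1, g|_S) ≥ 0` of all sub-families under `μ'` (`= (j-1)·E^{μ'}_j(g|_S)` by
branching).  Then for every slot `i`,
`E^μ_{k+2}(1_P, g_0,…,g_k) ≥ (E_{μ'} g_i − E_μ g_i) · E^μ_{k+1}(1_P, g_{−i})`.
Proof: `E^μ_{k+2}(1_P, g) = [t^{univ}] m·Q'·W` and `E^μ_{k+1}(1_P, g_{−i}) = [t^{univ∖i}]` of the SAME series
(restriction homomorphism), `Q' ≥ 0` by (ii), `W ≥ 0` and `W_τ ≥ δ_i W_{τ∖i}` (`coeff_changeWeight_ge`).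
[this work] -/
theorem sahiE_cons_setInd_ge_erase [DecidableEq α] (μ : α → ℝ) (hμ1 : ∑ x, μ x = 1) (μ' : α → ℝ)
    (hμ'1 : ∑ x, μ' x = 1) (P : Finset α) (m : ℝ) (hm : 0 ≤ m)
    (hμ' : ∀ x, m * μ' x = if x ∈ P then μ x else 0) {k : ℕ} (g : Fin (k + 1) → α → ℝ)
    (H : ∀ ρ : Finset (Fin (k + 1)), 0 ≤ ∑ x, (μ' x - μ x) * ∏ i ∈ ρ, g i x)
    (hq : ∀ (j : ℕ) (e : Fin j ↪ Fin (k + 1)), 0 ≤ sahiE μ' (j + 1) (Matrix.vecCons 1 fun l => g (e l)))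
    (i : Fin (k + 1)) :
    (∑ x, (μ' x - μ x) * g i x) * sahiE μ (k + 1) (Matrix.vecCons (setInd P) fun l => g (i.succAbove l)) ≤
      sahiE μ (k + 2) (Matrix.vecCons (setInd P) g) := by
  -- both functionals are coefficients of the same series `Q_{μ,P}(g) = m · Q' · W`
  have hsub : sahiE μ (k + 1) (Matrix.vecCons (setInd P) fun l => g (i.succAbove l)) =
      (qMark μ P g).coeff (univ.erase i) := by
    rw [sahiE_cons_setInd_eq μ hμ1 P (fun l => g (i.succAbove l)),
      show (fun l => g (i.succAbove l)) = fun l => g ((Fin.succAboveEmb i) l) from rfl,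
      ← res_qMark, coeff_res, map_univ_succAboveEmb]
  rw [sahiE_cons_setInd_eq μ hμ1 P g, hsub, qMark_eq_of_cond μ μ' P m hμ' g, coeff_C_mul, coeff_C_mul]
  -- `Q' ≥ 0` coefficientwise, by (ii)
  have hA : ∀ S, 0 ≤ (qMark μ' univ g).coeff S := by
    intro S
    obtain ⟨j, hj⟩ : ∃ j, S.card = j := ⟨_, rfl⟩
    let e : Fin j ↪ Fin (k + 1) := (S.orderEmbOfFin hj).toEmbedding
    have hmap : (univ : Finset (Fin j)).map e = S := map_univ_orderEmbOfFin S hj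
    rw [← hmap, ← coeff_res e (qMark μ' univ g) univ, res_qMark, ← sahiE_cons_one_eq μ' hμ'1]
    exact hq j e
  have hB := coeff_mul_ge_of_coeff_ge hA (coeff_changeWeight_nonneg μ μ' g H) i
    (coeff_changeWeight_ge μ μ' g H i) univ (mem_univ i)
  calc (∑ x, (μ' x - μ x) * g i x) *
        (m * (qMark μ' univ g * ∏ x, binomB (μ x - μ' x) (lin g x)).coeff (univ.erase i))
      = m * ((∑ x, (μ' x - μ x) * g i x) *
          (qMark μ' univ g * ∏ x, binomB (μ x - μ' x) (lin g x)).coeff (univ.erase i)) := by ring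
    _ ≤ m * (qMark μ' univ g * ∏ x, binomB (μ x - μ' x) (lin g x)).coeff univ :=
        mul_le_mul_of_nonneg_left hB hm

/-- **Positivity at a principal slot from the SPECIFIC sub-families** (the sharp form of the induction rule: only
the functionals of the sub-families of `g` under the conditional weight are needed, not order-`K` positivity of a
whole class of weights): under the hypotheses of `sahiE_cons_setInd_ge_erase` (without the slot),
`E^μ_{k+1}(1_P, g) ≥ 0`. [this work] -/
theorem sahiE_cons_setInd_nonneg_of_subfamilies [DecidableEq α] (μ : α → ℝ) (hμ1 : ∑ x, μ x = 1)
    (μ' : α → ℝ) (hμ'1 : ∑ x, μ' x = 1) (P : Finset α) (m : ℝ) (hm : 0 ≤ m)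
    (hμ' : ∀ x, m * μ' x = if x ∈ P then μ x else 0) {k : ℕ} (g : Fin k → α → ℝ)
    (H : ∀ ρ : Finset (Fin k), 0 ≤ ∑ x, (μ' x - μ x) * ∏ i ∈ ρ, g i x)
    (hq : ∀ (j : ℕ) (e : Fin j ↪ Fin k), 0 ≤ sahiE μ' (j + 1) (Matrix.vecCons 1 fun l => g (e l))) :
    0 ≤ sahiE μ (k + 1) (Matrix.vecCons (setInd P) g) := by
  rw [sahiE_cons_setInd_eq μ hμ1 P g, qMark_eq_of_cond μ μ' P m hμ' g, coeff_C_mul, coeff_mul]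
  refine mul_nonneg hm (Finset.sum_nonneg fun S _ => mul_nonneg ?_ (coeff_changeWeight_nonneg μ μ' g H _))
  obtain ⟨j, hj⟩ : ∃ j, S.card = j := ⟨_, rfl⟩
  let e : Fin j ↪ Fin k := (S.orderEmbOfFin hj).toEmbedding
  have hmap : (univ : Finset (Fin j)).map e = S := map_univ_orderEmbOfFin S hj
  rw [← hmap, ← coeff_res e (qMark μ' univ g) univ, res_qMark, ← sahiE_cons_one_eq μ' hμ'1]
  exact hq j e

end GF

end Summit.CriticalPhenomena.PercolationContinuityZ3.Theorems
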